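import Summits.BirchSwinnertonDyer.BirchSwinnertonDyer.Theorems.BiquadraticEisensteinDescentHeegnerTwistCouplingInSupplyQuarticTwistLocal
import HarnessLib

set_option linter.dupNamespace false -- `Summit.BirchSwinnertonDyer.BirchSwinnertonDyer.Theorems.…` (summit = sub)
set_option autoImplicit false

/-!
# Crux `HeegnerTwistCouplingInSupply` (stmt-BirchSwinnertonDyer-21381) — the QUARTIC `j = 1728` corner, I:
# descent via `2`-isogeny for `y² = x³ − 25pq²·x`, the side `S(0, −25pq²) = {1, −p}`

Route `BiquadraticEisensteinDescent` (cell `pub/bsd-wall`, width seat `bsd-wall-cm-bed-w4` g13; `--supports` 21381, helper;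
LEAD-VERDICT-ibd-p1-g11 §4 (ii) «other `j = 1728` curves»). For the corner `W_p⁻ : y² = x³ − p·x` (`p ≡ 7 (mod 8)`,
root number `−1`) twisted by `d = −5q` (`q ≡ 3 (mod 8)` prime, `(q/p) = −1`), the twist is `W^{(−5q)} : y² = x³ − 25pq²·x`,
`E = ⟨0, 0, 0, −25pq², 0⟩`, and descent via `2`-isogeny (Silverman AEC X.4.9 / X.6.1, tree `twoIsogenySelmerGroup`) runs on
the squarefree divisors of `b = −25pq²` (this file) and of `b′ = 100pq²` (sibling `…QuarticTwistDescentDual`).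

★ `mem_selmer_neg_iff`: for primes `p ≡ 7 (mod 8)`, `p ≡ 4 (mod 5)`, `q ≡ 3 (mod 8)` with `q` a non-residue mod `p`,
`S(0, −25pq²) = {1, −p}`. Of the sixteen squarefree divisors, `1` and `−p` are the images of `O` and `T = (0,0)`;
`−1, −pq, −5, −5pq, q, p, 5q, 5p` die at `p` (non-residues `−1, 25q, −5, 5q, q, −25q², 5q, −5q²`), `−5q, 5pq` die at `5`
(`p` is a square but not a fourth power mod `5`), and `−q, −5p, pq, 5` die at `2` (no solutions modulo `8`). The local
tools are the sibling `…QuarticTwistLocal`. Validated numerically beforehand (BSD Lemmas 6/7, 132/132 pairs).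

HONEST FRAMING: a typed sub-corner on one CM family (measure zero in «all CM `W`»); the crux (residual C⁺) is untouched;
BSD is not proved by any of this. THEOREMS ONLY (no `def`, no named fact, no sorry). Supports stmt-BirchSwinnertonDyer-21381.
-/

noncomputable section

open scoped Classical

namespace Summit.BirchSwinnertonDyer.BirchSwinnertonDyer.Theorems.BiquadraticEisensteinDescentHeegnerTwistCouplingInSupplyQuarticTwistDescent

open Literature.NumberTheory.EllipticCurves Literature.NumberTheory.EllipticCurves.XCubeAddPX
  Summit.BirchSwinnertonDyer.BirchSwinnertonDyer.Theorems.BiquadraticEisensteinDescentHeegnerTwistCouplingInSupplyQuarticTwistLocal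

/-! ## §3 The side `S(0, −25pq²)`: fourteen local kills and `S = {1, −p}` -/

section SSide

variable {p q : ℕ} [hp : Fact p.Prime] [hq : Fact q.Prime]

/-- Membership unfolded at a factorisation `d·d′ = b`. [folklore] -/
theorem isLocallySoluble_of_mem {a b d d' : ℤ} (hd0 : d ≠ 0) (hdd : d * d' = b)
    (h : d ∈ twoIsogenySelmerGroup a b) : (twoIsogenyQuartic a d d').IsLocallySoluble := by
  have h' := isLocallySoluble_of_mem_twoIsogenySelmerGroup h
  rwa [← hdd, Int.mul_ediv_cancel_left _ hd0] at h'

/-- The squarefree divisors of `25·p·q²` (`p, q ≠ 5` distinct primes... no: any primes `p, q`): their absolute values are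
among `1, 5, p, 5p, q, 5q, pq, 5pq` (a squarefree divisor of `n` divides its radical). [folklore] -/
theorem natAbs_eq_of_squarefree_dvd {d : ℤ} (hsq : Squarefree d) (hdvd : d ∣ (25 * p * q ^ 2 : ℤ)) :
    d.natAbs = 1 ∨ d.natAbs = 5 ∨ d.natAbs = p ∨ d.natAbs = 5 * p ∨ d.natAbs = q ∨ d.natAbs = 5 * q ∨
      d.natAbs = p * q ∨ d.natAbs = 5 * (p * q) := by
  set m := d.natAbs with hm_def
  have hmsq : Squarefree m := Int.squarefree_natAbs.mpr hsq
  have hm1 : m ∣ 25 * p * q ^ 2 := by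
    have h1 := Int.natAbs_dvd_natAbs.mpr hdvd
    have h2 : (25 * p * q ^ 2 : ℤ).natAbs = 25 * p * q ^ 2 := by
      rw [show (25 * p * q ^ 2 : ℤ) = ((25 * p * q ^ 2 : ℕ) : ℤ) by push_cast; ring, Int.natAbs_natCast]
    rwa [h2] at h1
  have hm2 : m ∣ (5 * (p * q)) ^ 2 :=
    dvd_trans hm1 ⟨p, by ring⟩
  have hm3 : m ∣ 5 * (p * q) := (hmsq.dvd_pow_iff_dvd two_ne_zero).mp hm2
  obtain ⟨a, b, ha, hb, hm⟩ := exists_dvd_and_dvd_of_dvd_mul hm3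
  obtain ⟨b₁, b₂, hb₁, hb₂, rfl⟩ := exists_dvd_and_dvd_of_dvd_mul hb
  rcases (Nat.dvd_prime Nat.prime_five).mp ha with ha' | ha' <;>
  rcases (Nat.dvd_prime hp.out).mp hb₁ with h1 | h1 <;>
  rcases (Nat.dvd_prime hq.out).mp hb₂ with h2 | h2 <;>
  · rw [hm, ha', h1, h2]; simp

/-- Casts modulo `8` from a residue. [folklore] -/
theorem natCast_zmod8_of_mod {n r : ℕ} (h : n % 8 = r) (hr : r < 8) : (n : ZMod 8) = (r : ZMod 8) :=
  (ZMod.natCast_eq_natCast_iff' n r 8).mpr (by rw [h, Nat.mod_eq_of_lt hr])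

/-- Casts modulo `5` from a residue. [folklore] -/
theorem natCast_zmod5_of_mod {n r : ℕ} (h : n % 5 = r) (hr : r < 5) : (n : ZMod 5) = (r : ZMod 5) :=
  (ZMod.natCast_eq_natCast_iff' n r 5).mpr (by rw [h, Nat.mod_eq_of_lt hr])

omit hp hq in
/-- **The four `2`-adic kills** (`p ≡ 7`, `q ≡ 3 (mod 8)`; no solutions modulo `8`): the classes `−q`, `−5p`, `pq`, `5`
of `S(0, −25pq²)`. [cite: SilvermanAEC2009, proof of Prop. X.6.2(b)] -/
theorem two_adic_kills (hp8 : p % 8 = 7) (hq8 : q % 8 = 3) :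
    ¬ ((twoIsogenyQuartic 0 (-(q : ℤ)) (25 * p * q)).map (Int.castRingHom ℚ_[2])).IsSoluble ∧
    ¬ ((twoIsogenyQuartic 0 (-(5 * p : ℤ)) (5 * q ^ 2)).map (Int.castRingHom ℚ_[2])).IsSoluble ∧
    ¬ ((twoIsogenyQuartic 0 ((p : ℤ) * q) (-(25 * q : ℤ))).map (Int.castRingHom ℚ_[2])).IsSoluble ∧
    ¬ ((twoIsogenyQuartic 0 (5 : ℤ) (-(5 * p * q ^ 2 : ℤ))).map (Int.castRingHom ℚ_[2])).IsSoluble := by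
  have hp' : (p : ZMod 8) = 7 := by simpa using natCast_zmod8_of_mod hp8 (by norm_num)
  have hq' : (q : ZMod 8) = 3 := by simpa using natCast_zmod8_of_mod hq8 (by norm_num)
  refine ⟨not_isSoluble_two_of_zmod8 ?_, not_isSoluble_two_of_zmod8 ?_, not_isSoluble_two_of_zmod8 ?_,
    not_isSoluble_two_of_zmod8 ?_⟩ <;>
  · push_cast
    rw [hp', hq']
    decide

/-- The forms `−a x⁴ + 4a y⁴` (`a ≠ 0`) are anisotropic modulo `5` (`x⁴ ∈ {0, 1}`). [folklore] -/
theorem anisotropic_mod_five_left :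
    ∀ a : ZMod 5, a ≠ 0 → ∀ x y : ZMod 5, -a * x ^ 4 + 4 * a * y ^ 4 = 0 → x = 0 ∧ y = 0 := by decide

/-- The forms `4a x⁴ − a y⁴` (`a ≠ 0`) are anisotropic modulo `5`. [folklore] -/
theorem anisotropic_mod_five_right :
    ∀ a : ZMod 5, a ≠ 0 → ∀ x y : ZMod 5, 4 * a * x ^ 4 + -a * y ^ 4 = 0 → x = 0 ∧ y = 0 := by decide

omit hp hq in
/-- **The two kills at `5`** (`p ≡ 4 (mod 5)`: `p` is a square but not a fourth power mod `5`): the classes `−5q` and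
`5pq` of `S(0, −25pq²)` — both coefficients divisible by `5`, reduced forms `∓q(x⁴ + y⁴)` anisotropic mod `5`.
[cite: SilvermanAEC2009, proof of Prop. X.6.2(b)] -/
theorem five_kills [Fact (Nat.Prime 5)] (hp5 : p % 5 = 4) (hq5 : q % 5 ≠ 0) :
    ¬ ((twoIsogenyQuartic 0 (-(5 * q : ℤ)) (5 * p * q)).map (Int.castRingHom ℚ_[5])).IsSoluble ∧
    ¬ ((twoIsogenyQuartic 0 (5 * ((p : ℤ) * q)) (-(5 * q : ℤ))).map (Int.castRingHom ℚ_[5])).IsSoluble := by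
  have hp' : (p : ZMod 5) = 4 := by simpa using natCast_zmod5_of_mod hp5 (by norm_num)
  have hq0 : (q : ZMod 5) ≠ 0 := by
    rw [Ne, ZMod.natCast_eq_zero_iff]
    exact fun h => hq5 (Nat.eq_zero_of_dvd_of_lt ((Nat.dvd_mod_iff (dvd_refl 5)).mpr h) (Nat.mod_lt q (by norm_num)))
  constructor
  · refine not_isSoluble_padic_of_dvd_of_dvd (ℓ := 5) (c := -(5 * q : ℤ)) (c' := 5 * p * q)
      (c₀ := -(q : ℤ)) (c₀' := (p : ℤ) * q) (by push_cast; ring) (by push_cast; ring) ?_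
    push_cast
    rw [hp']
    exact anisotropic_mod_five_left _ hq0
  · refine not_isSoluble_padic_of_dvd_of_dvd (ℓ := 5) (c := (5 * ((p : ℤ) * q))) (c' := -(5 * q : ℤ))
      (c₀ := (p : ℤ) * q) (c₀' := -(q : ℤ)) (by push_cast; ring) (by push_cast; ring) ?_
    push_cast
    rw [hp']
    exact anisotropic_mod_five_right _ hq0

/-- ★ **`S(0, −25pq²) = {1, −p}`** for primes `p ≡ 7 (mod 8)`, `p ≡ 4 (mod 5)`, `q ≡ 3 (mod 8)` with `q` a non-residue
mod `p`: descent on the divisors of `b = −25pq²` for the twist `W_p⁻^{(−5q)} : y² = x³ − 25pq²·x`. Of the sixteen squarefree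
divisors, `1` and `−p` are the images of `O` and `T = (0,0)`; `−1, −pq, −5, −5pq, q, p, 5q, 5p` die at `p`
(`−1, 25q, −5, 5q, q, −25q², 5q, −5q²` non-residues), `−5q, 5pq` at `5`, and `−q, −5p, pq, 5` at `2`.
[cite: SilvermanAEC2009, Prop. X.4.9 and Prop. X.6.1] -/
theorem mem_selmer_neg_iff (hp8 : p % 8 = 7) (hp5 : p % 5 = 4) (hq8 : q % 8 = 3)
    (hnq : ¬ IsSquare ((q : ℤ) : ZMod p)) (d : ℤ) :
    d ∈ twoIsogenySelmerGroup 0 (-(25 * p * q ^ 2 : ℤ)) ↔ d = 1 ∨ d = -(p : ℤ) := by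
  have hP := hp.out
  have hQ := hq.out
  have hqp : q ≠ p := by rintro rfl; omega
  have hp0 : (p : ℤ) ≠ 0 := by exact_mod_cast hP.ne_zero
  have hq0 : (q : ℤ) ≠ 0 := by exact_mod_cast hQ.ne_zero
  have hb : (-(25 * p * q ^ 2 : ℤ)) ≠ 0 :=
    neg_ne_zero.mpr (mul_ne_zero (mul_ne_zero (by norm_num) hp0) (pow_ne_zero 2 hq0))
  -- `p ∤ q`, `p ∤ 5`, `p ∤ 25`, as integers
  have hpq : ¬ (p : ℤ) ∣ q := fun h => hqp (((Nat.prime_dvd_prime_iff_eq hP hQ).mp (by exact_mod_cast h))).symm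
  have hp5' : ¬ (p : ℤ) ∣ 5 := fun h => by
    have h' : p ∣ 5 := by exact_mod_cast h
    rcases (Nat.dvd_prime Nat.prime_five).mp h' with h'' | h'' <;> omega
  have hpI : Prime (p : ℤ) := Nat.prime_iff_prime_int.mp hP
  have hnd : ∀ m : ℤ, ¬ (p : ℤ) ∣ m → ¬ (p : ℤ) ^ 2 ∣ (p : ℤ) * m := fun m hm => not_sq_dvd_mul_of_not_dvd hm
  have hn25q2 : ¬ (p : ℤ) ∣ 25 * q ^ 2 := by
    intro h
    rcases hpI.dvd_or_dvd h with h | h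
    · exact hp5' (hpI.dvd_of_dvd_pow (show (p : ℤ) ∣ 5 ^ 2 by norm_num at h ⊢; exact h))
    · exact hpq (hpI.dvd_of_dvd_pow h)
  have hn5q2 : ¬ (p : ℤ) ∣ 5 * q ^ 2 := by
    intro h
    rcases hpI.dvd_or_dvd h with h | h
    · exact hp5' h
    · exact hpq (hpI.dvd_of_dvd_pow h)
  have hn25q : ¬ (p : ℤ) ∣ 25 * q := by
    intro h
    rcases hpI.dvd_or_dvd h with h | h
    · exact hp5' (hpI.dvd_of_dvd_pow (show (p : ℤ) ∣ 5 ^ 2 by norm_num at h ⊢; exact h))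
    · exact hpq h
  have hn5q : ¬ (p : ℤ) ∣ 5 * q := by
    intro h
    rcases hpI.dvd_or_dvd h with h | h
    · exact hp5' h
    · exact hpq h
  have hp1 : ¬ (p : ℤ) ∣ 1 := fun h =>
    hP.one_lt.ne' (by exact_mod_cast Int.eq_one_of_dvd_one (by positivity) h)
  obtain ⟨hm1, hm5, h5q, h25q, hm25q2, hm5q2, -, -, -, -⟩ := nonresidues_mod_p hp8 hp5 hQ hqp hnq
  haveI : Fact (Nat.Prime 2) := ⟨Nat.prime_two⟩
  haveI : Fact (Nat.Prime 5) := ⟨Nat.prime_five⟩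
  have hq5 : q % 5 ≠ 0 := fun h => by
    rcases (Nat.dvd_prime hQ).mp (Nat.dvd_of_mod_eq_zero h) with h5 | h5 <;> omega
  obtain ⟨k1, k2, k3, k4⟩ := two_adic_kills (p := p) (q := q) hp8 hq8
  obtain ⟨f1, f2⟩ := five_kills (p := p) (q := q) hp5 hq5
  constructor
  · intro hd
    have hsq := squarefree_of_mem_twoIsogenySelmerGroup hd
    have hd0 : d ≠ 0 := hsq.ne_zero
    have hdvd : d ∣ (25 * p * q ^ 2 : ℤ) := dvd_neg.mp (dvd_of_mem_twoIsogenySelmerGroup hd)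
    have key : ∀ d' : ℤ, d * d' = -(25 * p * q ^ 2 : ℤ) → (twoIsogenyQuartic 0 d d').IsLocallySoluble :=
      fun d' hdd => isLocallySoluble_of_mem hd0 hdd hd
    rcases natAbs_eq_of_squarefree_dvd (p := p) (q := q) hsq hdvd with h | h | h | h | h | h | h | h <;>
      rcases Int.natAbs_eq d with hd' | hd' <;> rw [h] at hd' <;> push_cast at hd' <;> subst hd'
    · exact Or.inl rfl
    · -- d = -1 : dies at p
      refine absurd ((key (25 * p * q ^ 2) (by ring)).2 p) ?_
      exact not_isSoluble_padic_of_dvd_right (c := -1) (c' := 25 * p * q ^ 2) ⟨25 * q ^ 2, by ring⟩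
        (by rw [show (25 * p * q ^ 2 : ℤ) = p * (25 * q ^ 2) by ring]; exact hnd _ hn25q2) hm1
    · -- d = 5 : dies at 2
      exact absurd ((key (-(5 * p * q ^ 2)) (by ring)).2 2) k4
    · -- d = -5 : dies at p
      refine absurd ((key (5 * p * q ^ 2) (by ring)).2 p) ?_
      exact not_isSoluble_padic_of_dvd_right (c := -5) (c' := 5 * p * q ^ 2) ⟨5 * q ^ 2, by ring⟩
        (by rw [show (5 * p * q ^ 2 : ℤ) = p * (5 * q ^ 2) by ring]; exact hnd _ hn5q2) hm5
    · -- d = p : dies at p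
      refine absurd ((key (-(25 * q ^ 2)) (by ring)).2 p) ?_
      exact not_isSoluble_padic_of_dvd_left (c := (p : ℤ)) (c' := -(25 * q ^ 2)) (dvd_refl _)
        (by simpa using hnd 1 hp1) hm25q2
    · exact Or.inr rfl
    · -- d = 5p : dies at p
      refine absurd ((key (-(5 * q ^ 2)) (by ring)).2 p) ?_
      exact not_isSoluble_padic_of_dvd_left (c := 5 * (p : ℤ)) (c' := -(5 * q ^ 2)) ⟨5, by ring⟩
        (by rw [show (5 * p : ℤ) = p * 5 by ring]; exact hnd 5 hp5') hm5q2
    · -- d = -5p : dies at 2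
      exact absurd ((key (5 * q ^ 2) (by ring)).2 2) k2
    · -- d = q : dies at p
      refine absurd ((key (-(25 * p * q)) (by ring)).2 p) ?_
      exact not_isSoluble_padic_of_dvd_right (c := (q : ℤ)) (c' := -(25 * p * q)) ⟨-(25 * q), by ring⟩
        (by rw [show (-(25 * p * q) : ℤ) = p * (-(25 * q)) by ring]; exact hnd _ (by rwa [dvd_neg])) hnq
    · -- d = -q : dies at 2
      exact absurd ((key (25 * p * q) (by ring)).2 2) k1
    · -- d = 5q : dies at p
      refine absurd ((key (-(5 * p * q)) (by ring)).2 p) ?_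
      exact not_isSoluble_padic_of_dvd_right (c := 5 * (q : ℤ)) (c' := -(5 * p * q)) ⟨-(5 * q), by ring⟩
        (by rw [show (-(5 * p * q) : ℤ) = p * (-(5 * q)) by ring]; exact hnd _ (by rwa [dvd_neg])) h5q
    · -- d = -5q : dies at 5
      exact absurd ((key (5 * p * q) (by ring)).2 5) f1
    · -- d = pq : dies at 2
      exact absurd ((key (-(25 * q)) (by ring)).2 2) k3
    · -- d = -pq : dies at p
      refine absurd ((key (25 * q) (by ring)).2 p) ?_
      exact not_isSoluble_padic_of_dvd_left (c := -((p : ℤ) * q)) (c' := 25 * q) ⟨-q, by ring⟩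
        (by rw [show (-((p : ℤ) * q)) = p * (-q) by ring]; exact hnd _ (by rwa [dvd_neg])) h25q
    · -- d = 5pq : dies at 5
      exact absurd ((key (-(5 * q)) (by ring)).2 5) f2
    · -- d = -5pq : dies at p
      refine absurd ((key (5 * q) (by ring)).2 p) ?_
      exact not_isSoluble_padic_of_dvd_left (c := -(5 * ((p : ℤ) * q))) (c' := 5 * q) ⟨-(5 * q), by ring⟩
        (by rw [show (-(5 * ((p : ℤ) * q))) = p * (-(5 * q)) by ring]; exact hnd _ (by rwa [dvd_neg])) h5q
  · rintro (rfl | rfl)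
    · exact one_mem_twoIsogenySelmerGroup 0 hb
    · refine mem_twoIsogenySelmerGroup_of_isSquare hb ?_ ⟨25 * q ^ 2, by ring⟩ ⟨5 * q, ?_⟩
      · exact Int.squarefree_natAbs.mp (by rw [Int.natAbs_neg, Int.natAbs_natCast]; exact hP.prime.squarefree)
      · rw [show (-(25 * p * q ^ 2 : ℤ)) = -(p : ℤ) * (25 * q ^ 2) by ring,
          Int.mul_ediv_cancel_left _ (neg_ne_zero.mpr hp0)]
        ring

end SSide

end Summit.BirchSwinnertonDyer.BirchSwinnertonDyer.Theorems.BiquadraticEisensteinDescentHeegnerTwistCouplingInSupplyQuarticTwistDescent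

end
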